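import Literature.AlgebraicGeometry.Frobenioids.PadicFrobenioidThm12ivHolds
import HarnessLib

/-!
# Frobenioids I, Proposition 1.13 (iii) (b) for MODEL CATEGORIES, without the Frobenioid axioms:
# sharp `Φ`, group-like `B`, `⋂ₙ O^×(X)ⁿ = {1}` and `D` slim ⇒ the model Frobenioid is slim

Mochizuki, *The geometry of Frobenioids I: the general theory*, Kyushu J. Math. **62** (2008) 293–400,
§1, Proposition 1.13 (iii), kurims p. 40 [cite: MochizukiFrdI2008, Prop. 1.13(iii) p.40] ("Suppose …
that every object `A ∈ Ob(C)` satisfies … (b) `⋂_{n ∈ ℕ_{≥1}} {O^×(A)}^n = {1}`, and, moreover, there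
exists a co-angular pre-step `B → A` … Then the category `C` is slim"), and Remark 1.13.1 pp. 40–41
(the hypothesis cannot be dropped), for the model category `C = ModelFrobenioid Φ B Div_B` of the data
`(D, Φ, B, Div_B : B → Φ^gp)` of Theorem 5.2 (i) p. 100 [cite: MochizukiFrdI2008, Thm. 5.2(i) p.100].

PROOF-ONLY file (no definitions; abc-iut cell, seat abc-iut-f-047, FLOAT on FACT-LIST row F-0744
[EtTh] Thm. 3.7 (iv)). `ModelFrobenioid.isSlim_of_sharp_of_forall_pow`: for ANY data with the
divisor monoids `Φ(A)` SHARP (no non-trivial units — e.g. divisorial, or monoprime) and the rational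
function monoids `B(A)` group-like, if every object `X` satisfies condition (b) in the form the cell's
[EtTh] files use (an element of `O^×(X)` admitting an `n`-th root in `O^×(X)` for every `n ≥ 1` is
trivial) and `D` is slim, then `C` is slim — WITHOUT "`C` is a Frobenioid" (no "`Φ`, `B` monoids on
`D`", no total epimorphicity, no pull-back morphisms). Proof: a component `α` of an automorphism `η` of
`C_A → C` at `f : X → A` is a base-identity linear automorphism (`ModelFrobenioid.baseMap_autApp_eq_id`,
seat abc-iut-f-047, p429624: explicit lifts of the arrows of `D_{A_D}` and the slimness of `D`), hence
`α = (1, id, 0, u)` (`Φ(X_D)` sharp); writing the class of `X = (X_D, ξ)` as `ξ = of(a) − of(b)`, the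
arrow `g_n := (n, id, (n−1)·b + a, 0) : (X_D, −of(b)) → X` of Frobenius degree `n` EXISTS FOR EVERY `n`,
and naturality of `η` along `g_n` gives `u = n · u_n` for the component `(1, id, 0, u_n)` at `g_n ≫ f`
(`ModelFrobenioid.unit_eq_pow_of_comm`); transported to `X` (the relation `0 = Div_B(u_n)` does not
involve the class), `(1, id, 0, u_n) ∈ O^×(X)` is an `n`-th root of `α`; so (b) forces `α = 1`.
This is the exact converse of the mechanism of Remark 1.13.1 for model Frobenioids (seat abc-iut-f-049's
`ModelFrobenioid.not_isSlim_of_rootFamily`, p429783: a divisible root system of units makes `C`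
non-slim). Consumers: [FrdII] Thm. 1.2 (iv) (`PadicFrd.Datum.thm12_iv_holds`, where (b) holds by the
arithmetic of `p`-adic units) and [EtTh] Thm. 3.7 (iv) (`Discharge/Sec3Thm37SlimOfUnits.lean`).
Nothing here bears on [IUTchIII] Cor. 3.12.
-/

namespace Literature.AlgebraicGeometry.Frobenioids

namespace ModelFrobenioid

open CategoryTheory Opposite

universe w v u

variable {D : Type u} [Category.{v} D] {Φ B : Dᵒᵖ ⥤ CommMonCat.{w}} {DivB : B ⟶ monoidGp Φ}

/-- Powers in `O^×(X)` have the expected rational-function part: `u_{γⁿ} = n · u_γ` (the homomorphism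
`O^×(X) → B(X_D)^×`, `unitsToRatFn`). [cite: MochizukiFrdI2008, Thm. 5.2(ii) p.101] -/
theorem unit_pow_hom (X : ModelFrobenioid Φ B DivB) (γ : units X) (n : ℕ) :
    unit (γ ^ n).1.hom = unit γ.1.hom ^ n := by
  have h := congrArg Units.val (map_pow (unitsToRatFn X) γ n)
  rwa [Units.val_pow_eq_pow_val, coe_unitsToRatFn, coe_unitsToRatFn] at h

/-- **[FrdI] Prop. 1.13 (iii) (b) for model categories, without the Frobenioid axioms.** For the model
category `C` of data `(D, Φ, B, Div_B)` with every `Φ(A)` sharp and every `B(A)` group-like: if every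
object `X` satisfies "an element of `O^×(X)` with an `n`-th root in `O^×(X)` for every `n ≥ 1` is
trivial" (condition (b), `⋂ₙ O^×(X)ⁿ = {1}`) and `D` is slim, then `C` is slim. The components of an
automorphism of `C_A → C` are base-identity (`baseMap_autApp_eq_id`), hence units `(1, id, 0, u)`; the
degree-`n` arrows `(n, id, (n−1)·b + a, 0) : (X_D, −of(b)) → (X_D, of(a) − of(b))`, which always exist,
exhibit `u` as `n · u_n` (`unit_eq_pow_of_comm`), and `(1, id, 0, u_n)` transported to `X` is an `n`-th root
of the component in `O^×(X)`. [cite: MochizukiFrdI2008, Prop. 1.13(iii) p.40] -/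
theorem isSlim_of_sharp_of_forall_pow (hΦ : ∀ A : D, IsSharp (Φ.obj (op A)))
    (hB : ∀ (A : D) (u : B.obj (op A)), IsUnit u)
    (hdiv : ∀ (X : ModelFrobenioid Φ B DivB) (α : Aut X), α ∈ units X →
      (∀ n : ℕ+, ∃ β : Aut X, β ∈ units X ∧ β ^ (n : ℕ) = α) → α = 1)
    (hD : IsSlim D) : IsSlim (ModelFrobenioid Φ B DivB) := by
  refine ⟨fun A η => Iso.ext (NatTrans.ext (funext fun U => ?_))⟩
  -- every component is a base-identity linear automorphism, i.e. lies in `O^×(−)`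
  have hmem : ∀ W : Over A, PreFrobenioid.autApp η W ∈ units W.left := fun W =>
    ⟨baseMap_autApp_eq_id hD η W, (degFr_hom_eq_one _).1⟩
  suffices h : PreFrobenioid.autApp η U = 1 from congrArg Iso.hom h
  refine hdiv U.left _ (hmem U) fun n => ?_
  have hsharp : IsSharp (Φ.obj (op U.left.base)) := hΦ _
  -- `ξ = of(a) − of(b)`; the arrow `g = (n, id, (n-1)·b + a, 0) : (X_D, −of(b)) → X = (X_D, ξ)`
  obtain ⟨a, b, hab⟩ := grothendieckGroup_exists_mul_of_eq_of U.left.cls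
  let g : (⟨U.left.base, (Algebra.GrothendieckGroup.of b)⁻¹⟩ : ModelFrobenioid Φ B DivB) ⟶ U.left :=
    { degFr := n, base := 𝟙 U.left.base, div := b ^ n.natPred * a, unit := 1
      rel := by
        show (Algebra.GrothendieckGroup.of b)⁻¹ ^ (n : ℕ) *
            Algebra.GrothendieckGroup.of (b ^ n.natPred * a) =
          pullGp Φ (𝟙 U.left.base) U.left.cls * divB Φ B DivB (op U.left.base) 1
        rw [pullGp_id, map_one, mul_one, map_mul, map_pow, ← hab, ← PNat.natPred_add_one n, inv_pow,
          pow_succ, inv_mul_eq_iff_eq_mul, mul_assoc, mul_comm U.left.cls] }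
  let Un : Over A := Over.mk (g ≫ U.hom)
  have hβ : PreFrobenioid.autApp η Un ∈ units Un.left := hmem Un
  -- naturality along `g`: `u_U = n · u_{U_n}`
  have hpow : unit (PreFrobenioid.autApp η U).hom =
      unit (PreFrobenioid.autApp η Un).hom ^ (n : ℕ) :=
    unit_eq_pow_of_comm (hB U.left.base) g rfl (PreFrobenioid.autApp η Un).hom
      (PreFrobenioid.autApp η U).hom hβ.1 (hmem U).2
      (PreFrobenioid.autApp_naturality η (Over.homMk g rfl : Un ⟶ U))
  -- transport `(1, id, 0, u_{U_n})` to an automorphism of `X` (the relation does not involve the class)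
  have h1 : Algebra.GrothendieckGroup.of (1 : Φ.obj (op U.left.base)) =
      divB Φ B DivB (op U.left.base) (unit (PreFrobenioid.autApp η Un).hom :) := by
    have h := of_div_eq_divB_unit_of_mem_units hβ
    rwa [div_eq_one_of_mem_units (X := Un.left) hsharp hβ] at h
  have h2 : Algebra.GrothendieckGroup.of (1 : Φ.obj (op U.left.base)) =
      divB Φ B DivB (op U.left.base) (unit (PreFrobenioid.autApp η Un).inv :) := by
    have h := of_div_eq_divB_unit_of_mem_units ((units Un.left).inv_mem hβ)
    rwa [div_eq_one_of_mem_units (X := Un.left) hsharp ((units Un.left).inv_mem hβ)] at h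
  let β' : Aut U.left :=
    unitAut U.left 1 1 (unit (PreFrobenioid.autApp η Un).hom :) (unit (PreFrobenioid.autApp η Un).inv :)
      h1 h2 (one_mul 1) (div_inv_mul_div_of_mem_units hβ).2
  have hβ' : β' ∈ units U.left := unitAut_mem_units _ _ _ _ _ _ _ _ _
  have hβ'n : β' ^ (n : ℕ) ∈ units U.left := (units U.left).pow_mem hβ' _
  refine ⟨β', hβ', ?_⟩
  -- `β'ⁿ = α`: both are `(1, id, 0, n · u_{U_n})`
  apply Aut.ext
  apply hom_ext
  · rw [hβ'n.2, (hmem U).2]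
  · rw [hβ'n.1, (hmem U).1]
  · rw [div_eq_one_of_mem_units hsharp hβ'n, div_eq_one_of_mem_units hsharp (hmem U)]
  · rw [hpow]
    exact unit_pow_hom U.left ⟨β', hβ'⟩ n

/-- The same with condition (b) phrased over found's `O^×(X) = PreFrobenioid.unitsSubgroup` of the
structure functor `C → F_Φ` (`toElem`; the same subgroup as `units X`, definitionally) — the form in
which the cell's [EtTh] Thm. 3.7 files carry the hypothesis `⋂ₙ O^×(A)ⁿ = 1`.
[cite: MochizukiFrdI2008, Prop. 1.13(iii) p.40] -/
theorem isSlim_of_sharp_of_forall_pow' (hΦ : ∀ A : D, IsSharp (Φ.obj (op A)))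
    (hB : ∀ (A : D) (u : B.obj (op A)), IsUnit u)
    (hdiv : ∀ (X : ModelFrobenioid Φ B DivB) (α : Aut X),
      α ∈ PreFrobenioid.unitsSubgroup (toElem Φ B DivB) X →
        (∀ n : ℕ+, ∃ β : Aut X, β ∈ PreFrobenioid.unitsSubgroup (toElem Φ B DivB) X ∧
          β ^ (n : ℕ) = α) → α = 1)
    (hD : IsSlim D) : IsSlim (ModelFrobenioid Φ B DivB) :=
  isSlim_of_sharp_of_forall_pow hΦ hB (fun X α hα h => hdiv X α hα h) hD

end ModelFrobenioid

end Literature.AlgebraicGeometry.Frobenioids
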